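import Summits.BirchSwinnertonDyer.BirchSwinnertonDyer.Theorems.ByReductionTypeAtTwoMultLowerHalfDescent
import Summits.BirchSwinnertonDyer.Rank1Residual.X5.TwoAdicInstancesToolkit
import Literature.NumberTheory.EllipticCurves.IsogenyFormulaCert
import HarnessLib

/-!
# Route `ByReductionTypeAtTwo`, items 19923/19922 per class: the class **225330bb** (4 members, split
# multiplicative at `2`, `#Ш_an = 64, 16, 64, 64`) — the ONE analytic-rank-0 K = 2 multiplicative class of
# the X5 level census that descent did NOT close (engine G not run at a `t = 2` representative):
# `BSD(·,2)` for every member by «Kato above, descent below»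

HONEST FRAMING (cell `bsd-2adic`, run/shared/lean/pub/bsd-2adic/, seat `bsd-2adic-mult-3` GEN 2, D-0074
row (A)): research route; nothing is booked (D-0054); BSD is not proved by any of this. PARTITION: X5@2 mult
(K4ᵐ, RESIDUAL-MAP B1·O1; 1 976 book230 classes) × p = 2 — ONE class, Cremona **225330bb**
(`N = 225330 = 2·3·5·7·29·37`, semistable, SPLIT multiplicative at `2`, analytic rank `0`; bb1
`[1,1,1,−83843886,−295533388197]` (`#Ш_an = 64`, `X₀(N)`-optimal, Cremona code `1`), bb2
`[1,1,1,−83843906,−295533240181]` (`#Ш_an = 16`, full rational `2`-torsion), bb3 `[1,1,1,−84478456,−290833509061]`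
(`64`), bb4 `[1,1,1,−83209676,−300223497877]` (`64`)). In the sha-1 LEVEL CENSUS this is a K = 2 class whose
representative bb2 has `t = 2`, where engine G (the exactness bit `Ш[8] = Ш[4]`) was not run — the only
analytic-rank-0 K = 2 multiplicative class among 1 855 left «F-only» (seat census
`evidence-19923-descent-census.md`). types-the-object-of → per-class CANDIDATE; closes none.

THE TWO LANES MEET AT bb2. LOWER (item 19923's instance): the level-2 datum at bb2 — `dim Sel₂ = t + 2 = 4`
(engines A = B, two-engine) and engine F's explicit 4-descent all-lift (every 2-Selmer class lifts to
`Sel⁽⁴⁾`; sha-1 `levels/compare_AF_K2.json` row `225330bb2`: OK, 4, 4, all_lift) ⇒ `Ш[2] ≅ (ℤ/2)²`,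
`Ш[2] ⊂ 2Ш[4]` ⇒ `#Ш[4] = 16` ⇒ READ as the binder `hdvd : 2⁴ ∣ #Ш(bb2)` (Selmer lines convert by
`two_pow_four_dvd_shaOrder_of_selmer_level2`), with `#Ш_an(bb2) = 16`. UPPER (item 19922's instance): mult-2's
road `missingUpperBoundAt_two_mult_of_roadMember` (p418902) AT bb2 — `μ = 0` PRINT by Greenberg's Prop. 5.14
at `2` through the type-B point `(−5291, 2645)` (odd: least root of `(x + 5291)(x + 5283)(4x − 42291)`; not
ramified: integral); period input the displayed certificate `hper₀` (bb1, bb2, bb3 share the real lattice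
`Ω = 0.0498920909…`, bb1 is `X₀(N)`-optimal, so bb2's `ϖ` is the optimal one, where `0 ≤ ord₂ ϖ` is PRINT by
Česnavičius 2018 Thm. 1.2). Then `bsdp_two_mult_of_roadMember_of_levelMember` (W = W₁ = W₂ = bb2) and
bb1, bb3, bb4 by `O1.bsdp_two_iff_of_isIsogenous` along the KERNEL-CHECKED Vélu `2`-isogenies bb1 → bb2,
bb2 → bb3, bb2 → bb4 (exact rational Vélu data of this seat, `[u,r,s,t] = [1,0,0,0]`).

DISPLAYED BINDERS: PRINT {A235 `h41ns`, A236 `h41sp`, modularity `hmod`/`hL`, GZK `hGZK`, Cassels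
`hCassels`, Prop. 5.14 at `2` `h514`, Česnavičius `hC`} + MEMO {Kato `⊗ℚ` at a multiplicative `2` `hKato`
(PROOF-MULT, RC-2 PASS), Greenberg–Stevens at a split `2` `hGS` (PROOF-GS2, RC-4 PASS)} + CERTIFICATE/RECORD
{`hper₀` at bb2, `hr : r_an(bb2) = 0`, `hq : #Ш_an(bb2) = 16` (Cremona allbsd), `hdvd : 2⁴ ∣ #Ш(bb2)` (the
level-2 datum)}; ellipticity, minimality, multiplicative reduction at `2`, the 5.14 point, the isogenies
DECIDED BY THE KERNEL. WHAT THIS IS NOT: not a discharge of any binder; not a theorem about every `W`.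

References: [GreenbergLNM1716] Prop. 5.14, §4 pp. 112–113; [Kato2004Asterisque] Thm. 17.4/17.13;
[Cesnavicius2018] Thm. 1.2; [Cassels1965ArithmeticVIII]; [Cassels1998] §1; [MerrimanSiksekSmart1996] §4;
[SilvermanAEC2009] III.4.8, VII.1.1, VII.5.1, X.4.2; [CremonaAlgorithms1997] Table 1 (225330bb);
[Miller2011LMS] Def. 1.1; cell files `b2b-bsdres-sha-1/levels/LEVEL-CENSUS-N5e5.md` §2.
-/

set_option autoImplicit false
set_option linter.dupNamespace false

noncomputable section

open scoped Classical MatrixGroups ModularForm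

open IsDedekindDomain CongruenceSubgroup WeierstrassCurve Literature.NumberTheory.EllipticCurves
  Literature.NumberTheory.EllipticCurves.ModularForms
  Literature.NumberTheory.EllipticCurves.Greenberg1999
  Literature.NumberTheory.EllipticCurves.PolyCert
  Literature.NumberTheory.EllipticCurves.Rank1Residual
  Literature.NumberTheory.EllipticCurves.Rank1Residual.Typed
  Summit.BirchSwinnertonDyer.Rank1Residual
  Summit.BirchSwinnertonDyer.Rank1Residual.X5
  Summit.BirchSwinnertonDyer.Rank1Residual.X5.Instances

namespace Summit.BirchSwinnertonDyer.BirchSwinnertonDyer.Theorems.L2C225330bb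

/-! ## §1 Cremona's four models -/

/-- Cremona `225330bb1` (integer model; `X₀(N)`-optimal). [cite: CremonaAlgorithms1997, Table 1] -/
abbrev Mbb1 : WeierstrassCurve ℤ := ⟨1, 1, 1, -83843886, -295533388197⟩
/-- Cremona `225330bb2` (integer model; full rational `2`-torsion). [cite: CremonaAlgorithms1997, Table 1] -/
abbrev Mbb2 : WeierstrassCurve ℤ := ⟨1, 1, 1, -83843906, -295533240181⟩
/-- Cremona `225330bb3` (integer model). [cite: CremonaAlgorithms1997, Table 1] -/
abbrev Mbb3 : WeierstrassCurve ℤ := ⟨1, 1, 1, -84478456, -290833509061⟩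
/-- Cremona `225330bb4` (integer model). [cite: CremonaAlgorithms1997, Table 1] -/
abbrev Mbb4 : WeierstrassCurve ℤ := ⟨1, 1, 1, -83209676, -300223497877⟩
/-- `225330bb1 / ℚ`. [cite: CremonaAlgorithms1997, Table 1] -/
abbrev bb1 : WeierstrassCurve ℚ := Mbb1.baseChange ℚ
/-- `225330bb2 / ℚ`. [cite: CremonaAlgorithms1997, Table 1] -/
abbrev bb2 : WeierstrassCurve ℚ := Mbb2.baseChange ℚ
/-- `225330bb3 / ℚ`. [cite: CremonaAlgorithms1997, Table 1] -/
abbrev bb3 : WeierstrassCurve ℚ := Mbb3.baseChange ℚ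
/-- `225330bb4 / ℚ`. [cite: CremonaAlgorithms1997, Table 1] -/
abbrev bb4 : WeierstrassCurve ℚ := Mbb4.baseChange ℚ

/-- `Δ(225330bb1) = 64392103440`. [cite: CremonaAlgorithms1997, Table 1] -/
theorem Mbb1_Δ : Mbb1.Δ = 64392103440 := by decide
/-- `Δ(225330bb2) = 64786609147307184900`. [cite: CremonaAlgorithms1997, Table 1] -/
theorem Mbb2_Δ : Mbb2.Δ = 64786609147307184900 := by decide
/-- `c₄(225330bb2) = 4024507489` (odd). [cite: CremonaAlgorithms1997, Table 1] -/
theorem Mbb2_c₄ : Mbb2.c₄ = 4024507489 := by decide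
/-- `Δ(225330bb3) = 2053444492972843067813310`. [cite: CremonaAlgorithms1997, Table 1] -/
theorem Mbb3_Δ : Mbb3.Δ = 2053444492972843067813310 := by decide
/-- `Δ(225330bb4) = −2056554250475663868378750`. [cite: CremonaAlgorithms1997, Table 1] -/
theorem Mbb4_Δ : Mbb4.Δ = -2056554250475663868378750 := by decide

/-- `225330bb1` is an elliptic curve. [cite: CremonaAlgorithms1997, Table 1] -/
instance bb1_isElliptic : bb1.IsElliptic := by
  rw [WeierstrassCurve.isElliptic_iff, baseChange_int_Δ, Mbb1_Δ]; norm_num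
/-- `225330bb2` is an elliptic curve. [cite: CremonaAlgorithms1997, Table 1] -/
instance bb2_isElliptic : bb2.IsElliptic := by
  rw [WeierstrassCurve.isElliptic_iff, baseChange_int_Δ, Mbb2_Δ]; norm_num
/-- `225330bb3` is an elliptic curve. [cite: CremonaAlgorithms1997, Table 1] -/
instance bb3_isElliptic : bb3.IsElliptic := by
  rw [WeierstrassCurve.isElliptic_iff, baseChange_int_Δ, Mbb3_Δ]; norm_num
/-- `225330bb4` is an elliptic curve. [cite: CremonaAlgorithms1997, Table 1] -/
instance bb4_isElliptic : bb4.IsElliptic := by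
  rw [WeierstrassCurve.isElliptic_iff, baseChange_int_Δ, Mbb4_Δ]; norm_num

/-- Cremona's model `225330bb1` is globally minimal (`gcd(Δ, c₄) = 1`, semistable). [cite: SilvermanAEC2009, VII.1 Remark 1.1] -/
instance bb1_isGloballyMinimal : bb1.IsGloballyMinimal :=
  isGloballyMinimal_baseChange_int_of_gcd_eq_one 1 1 1 (-83843886) (-295533388197) (by decide)
/-- Cremona's model `225330bb2` is globally minimal (`gcd(Δ, c₄) = 1`). [cite: SilvermanAEC2009, VII.1 Remark 1.1] -/
instance bb2_isGloballyMinimal : bb2.IsGloballyMinimal :=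
  isGloballyMinimal_baseChange_int_of_gcd_eq_one 1 1 1 (-83843906) (-295533240181) (by decide)
/-- Cremona's model `225330bb3` is globally minimal (`gcd(Δ, c₄) = 1`). [cite: SilvermanAEC2009, VII.1 Remark 1.1] -/
instance bb3_isGloballyMinimal : bb3.IsGloballyMinimal :=
  isGloballyMinimal_baseChange_int_of_gcd_eq_one 1 1 1 (-84478456) (-290833509061) (by decide)
/-- Cremona's model `225330bb4` is globally minimal (`gcd(Δ, c₄) = 1`). [cite: SilvermanAEC2009, VII.1 Remark 1.1] -/
instance bb4_isGloballyMinimal : bb4.IsGloballyMinimal :=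
  isGloballyMinimal_baseChange_int_of_gcd_eq_one 1 1 1 (-83209676) (-300223497877) (by decide)

/-- `Δ(225330bb2)` and `c₄(225330bb2)` are coprime (semistable model). [cite: SilvermanAEC2009, VII.5 Prop. 5.1(b)] -/
theorem Mbb2_coprime : IsCoprime Mbb2.Δ Mbb2.c₄ := by
  rw [Mbb2_Δ, Mbb2_c₄, Int.isCoprime_iff_gcd_eq_one]; decide

/-- **`225330bb2` is multiplicative at `2`** (`2 ∣ Δ`, `2 ∤ c₄`). [cite: SilvermanAEC2009, VII.5 Prop. 5.1(b)] -/
theorem mult_two_bb2 : Mult bb2 2 := by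
  have hgen : Rat.HeightOneSpectrum.natGenerator
      ((Rat.HeightOneSpectrum.primesEquiv (R := ℤ)).symm ⟨2, Nat.prime_two⟩) = 2 :=
    Literature.NumberTheory.EllipticCurves.Rat.natGenerator_primesEquiv_symm ⟨2, Nat.prime_two⟩
  have hm := hasMultiplicativeReductionAt_baseChange_int_of_isCoprime Mbb2 Mbb2_coprime
    (v := (Rat.HeightOneSpectrum.primesEquiv (R := ℤ)).symm ⟨2, Nat.prime_two⟩)
    (by rw [hgen, Mbb2_Δ]; decide)
  exact (hasMultiplicativeReductionAtPrime_iff_hasMultiplicativeReductionAt_holds bb2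
    ⟨2, Nat.prime_two⟩).mpr hm

/-! ## §2 The Prop-5.14 point of bb2: `(−5291, 2645)`, Greenberg type B -/

/-- The coefficients of `225330bb2 / ℚ` (unfolded). [cite: CremonaAlgorithms1997, Table 1] -/
theorem bb2_eq : bb2 = ⟨1, 1, 1, -83843906, -295533240181⟩ := by
  rw [bb2, baseChange_int_eq]; norm_num

/-- `b₂, b₄, b₆` of `225330bb2`: `2`-division cubic `4x³ + 5x² − 335375622x − 1182132960723 =
(x + 5291)(x + 5283)(4x − 42291)`. [cite: SilvermanAEC2009, III.1] -/
theorem bb2_b : bb2.b₂ = 5 ∧ bb2.b₄ = -167687811 ∧ bb2.b₆ = -1182132960723 := by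
  rw [bb2_eq]
  simp only [WeierstrassCurve.b₂, WeierstrassCurve.b₄, WeierstrassCurve.b₆]
  norm_num

/-- The rational point `(−5291, 2645)` of order `2` on `225330bb2`. [cite: CremonaAlgorithms1997, Table 1] -/
theorem bb2_P : bb2.toAffine.Equation (-5291) 2645 ∧
    2 * (2645 : ℚ) + bb2.a₁ * (-5291) + bb2.a₃ = 0 := by
  rw [bb2_eq, WeierstrassCurve.Affine.equation_iff]; norm_num

/-- **`(−5291, 2645)` is "odd"**: `−5291` is the least real root of the `2`-division cubic (roots
`−5291 < −5283 < 42291/4`). [cite: GreenbergLNM1716, §5 Remark (chunk p0174)] -/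
theorem bb2_odd : TwoTorsionOdd bb2 (-5291) := by
  intro r hr
  obtain ⟨hb₂, hb₄, hb₆⟩ := bb2_b
  rw [hb₂, hb₄, hb₆] at hr
  push_cast at hr
  have hfac : (r + 5291) * ((r + 5283) * (4 * r - 42291)) = 0 := by linear_combination hr
  rcases mul_eq_zero.mp hfac with h | h
  · push_cast; linarith
  · rcases mul_eq_zero.mp h with h' | h'
    · push_cast; linarith
    · push_cast; linarith

/-- **The Prop-5.14 datum of bb2** (type B: odd, not ramified at `2`). [cite: GreenbergLNM1716, Prop. 5.14 (p. 121)] -/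
theorem bb2_prop514 : ∃ x y : ℚ, bb2.toAffine.Equation x y ∧ 2 * y + bb2.a₁ * x + bb2.a₃ = 0 ∧
    ((TwoTorsionRamifiedAtTwo x ∧ ¬ TwoTorsionOdd bb2 x) ∨
      (TwoTorsionOdd bb2 x ∧ ¬ TwoTorsionRamifiedAtTwo x)) :=
  ⟨-5291, 2645, bb2_P.1, bb2_P.2,
    Or.inr ⟨bb2_odd, by simpa using not_twoTorsionRamifiedAtTwo_intCast (-5291)⟩⟩

/-! ## §3 The three Vélu `2`-isogenies as kernel-checked certificates -/

/-- Vélu's `2`-isogeny `225330bb1 → 225330bb2`, kernel `⟨(−5287, 2643)⟩`, as an `IsogenyCert` (exact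
rational Vélu data, `[u,r,s,t] = [1,0,0,0]`). [cite: SilvermanAEC2009, Thm. III.4.8 and Remark III.4.13.3] -/
def cert_bb1_bb2 : IsogenyCert where
  a₁ := 1; a₂ := 1; a₃ := 1; a₄ := -83843886; a₆ := -295533388197
  a₁' := 1; a₂' := 1; a₃' := 1; a₄' := -83843906; a₆' := -295533240181
  U := [21148, 27952373, 10574, 1]
  h := [5287, 1]
  S := [147784153755, 83857103, 15861, 1]
  T := [-55915312, -31724, -4]

/-- Vélu's `2`-isogeny `225330bb2 → 225330bb3`, kernel `⟨(−5291, 2645)⟩`. [cite: SilvermanAEC2009, Thm. III.4.8 and Remark III.4.13.3] -/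
def cert_bb2_bb3 : IsogenyCert where
  a₁ := 1; a₂ := 1; a₃ := 1; a₄ := -83843906; a₆ := -295533240181
  a₁' := 1; a₂' := 1; a₃' := 1; a₄' := -84478456; a₆' := -290833509061
  U := [671480810, 28121591, 10582, 1]
  h := [5291, 1]
  S := [147448376361, 83857133, 15873, 1]
  T := [-1776738223260, -1007284670, -126910]

/-- Vélu's `2`-isogeny `225330bb2 → 225330bb4`, kernel `⟨(−5283, 2641)⟩`. [cite: SilvermanAEC2009, Thm. III.4.8 and Remark III.4.13.3] -/
def cert_bb2_bb4 : IsogenyCert where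
  a₁ := 1; a₂ := 1; a₃ := 1; a₄ := -83843906; a₆ := -295533240181
  a₁' := 1; a₂' := 1; a₃' := 1; a₄' := -83209676; a₆' := -300223497877
  U := [-670127418, 27783243, 10566, 1]
  h := [5283, 1]
  S := [148119127605, 83857113, 15849, 1]
  T := [1770476638356, 1005254550, 126846]

/-- The certificate bb1 → bb2 checks (by the kernel). [folklore] -/
theorem cert_bb1_bb2_check : cert_bb1_bb2.check = true := by decide +kernel
/-- The certificate bb2 → bb3 checks. [folklore] -/
theorem cert_bb2_bb3_check : cert_bb2_bb3.check = true := by decide +kernel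
/-- The certificate bb2 → bb4 checks. [folklore] -/
theorem cert_bb2_bb4_check : cert_bb2_bb4.check = true := by decide +kernel

/-- **`225330bb1 ∼ 225330bb2`** (isogenous over `ℚ`). [cite: SilvermanAEC2009, Thm. III.4.8] -/
theorem isIsogenous_bb1_bb2 : IsIsogenous bb1 bb2 :=
  IsogenyCert.isIsogenous cert_bb1_bb2 cert_bb1_bb2_check
    (by rw [bb1, baseChange_int_eq]; rfl) (by rw [bb2, baseChange_int_eq]; rfl)
/-- **`225330bb2 ∼ 225330bb3`**. [cite: SilvermanAEC2009, Thm. III.4.8] -/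
theorem isIsogenous_bb2_bb3 : IsIsogenous bb2 bb3 :=
  IsogenyCert.isIsogenous cert_bb2_bb3 cert_bb2_bb3_check
    (by rw [bb2, baseChange_int_eq]; rfl) (by rw [bb3, baseChange_int_eq]; rfl)
/-- **`225330bb2 ∼ 225330bb4`**. [cite: SilvermanAEC2009, Thm. III.4.8] -/
theorem isIsogenous_bb2_bb4 : IsIsogenous bb2 bb4 :=
  IsogenyCert.isIsogenous cert_bb2_bb4 cert_bb2_bb4_check
    (by rw [bb2, baseChange_int_eq]; rfl) (by rw [bb4, baseChange_int_eq]; rfl)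

/-! ## §4 Item 19923's instance for the whole class from the ONE level-2 datum at bb2 (PRINT + record) -/

/-- **The LOWER half at all four members of 225330bb** from PRINT {GZK, Cassels, modularity} + Cremona's
`r_an(bb2) = 0`, `#Ш_an(bb2) = 16` + the level-2 datum at bb2 read as `2⁴ ∣ #Ш(bb2)` (engines A = B: `dim
Sel₂ = t + 2`; engine F: all-lift). bb1, bb3, bb4 (`#Ш_an = 64`) get it by TRANSPORT. Item
stmt-BirchSwinnertonDyer-19923 restricted to this class. [cite: Cassels1965ArithmeticVIII]
[cite: MerrimanSiksekSmart1996, §4] [cite: Miller2011LMS, Def. 1.1] -/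
theorem missingLowerBoundAt_two_class
    (hGZK : rank_eq_analyticRank_of_analyticRank_le_one) (hCassels : bsdRHS_eq_of_isIsogenous)
    (hL : hasEntireLFunction_rat) (hr : bb2.analyticRank = 0)
    (hq : shaAn bb2 = ((16 : ℚ) : ℂ)) (hdvd : 2 ^ 4 ∣ bb2.shaOrder) :
    MissingLowerBoundAt bb1 2 ∧ MissingLowerBoundAt bb2 2 ∧ MissingLowerBoundAt bb3 2 ∧
      MissingLowerBoundAt bb4 2 := by
  have hv : padicValRat 2 (16 : ℚ) ≤ ((4 : ℕ) : ℤ) := by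
    rw [show (16 : ℚ) = ((2 ^ 4 : ℕ) : ℚ) by norm_num, padicValRat.of_nat, padicValNat.prime_pow]
  have hr1 : bb1.analyticRank = 0 := by rw [analyticRank_eq_of_isIsogenous' isIsogenous_bb1_bb2, hr]
  have hr3 : bb3.analyticRank = 0 := by rw [← analyticRank_eq_of_isIsogenous' isIsogenous_bb2_bb3, hr]
  have hr4 : bb4.analyticRank = 0 := by rw [← analyticRank_eq_of_isIsogenous' isIsogenous_bb2_bb4, hr]
  refine ⟨?_, ?_, ?_, ?_⟩
  · exact missingLowerBoundAt_two_of_levelMember hGZK hCassels hL bb1 hr1 bb2 isIsogenous_bb1_bb2 hq hv hdvd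
  · exact missingLowerBoundAt_two_of_levelMember hGZK hCassels hL bb2 hr bb2 (IsIsogenous.refl_holds bb2)
      hq hv hdvd
  · exact missingLowerBoundAt_two_of_levelMember hGZK hCassels hL bb3 hr3 bb2
      isIsogenous_bb2_bb3.symm_of_charZero hq hv hdvd
  · exact missingLowerBoundAt_two_of_levelMember hGZK hCassels hL bb4 hr4 bb2
      isIsogenous_bb2_bb4.symm_of_charZero hq hv hdvd

/-! ## §5 `BSD(·,2)` for the class: Kato above (bb2, Prop 5.14 type B), descent below (bb2, level 2) -/

/-- **`BSD(225330bb2, 2)`** from PRINT {`h41ns h41sp hmod hL hGZK hCassels h514 hC`} + MEMO {`hKato` (RC-2),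
`hGS` (RC-4; live: split `2`)} + CERTIFICATES {`hper₀` (= the `X₀(N)`-optimal bb1's `ϖ`, same real lattice;
PRINT there by Česnavičius), `hr`, `hq : #Ш_an = 16`, `hdvd : 2⁴ ∣ #Ш(bb2)` (level-2 datum, engines
A/B/F)}; the type-B point, `Mult`, minimality, ellipticity decided by the kernel. Instance of
`bsdp_two_mult_of_roadMember_of_levelMember` with `W = W₁ = W₂ = bb2`.
[cite: GreenbergLNM1716, Prop. 5.14 and §4 pp. 112–113] [cite: Kato2004Asterisque, Thm. 17.4 (p. 273)]
[cite: MerrimanSiksekSmart1996, §4] [cite: Miller2011LMS, Def. 1.1] -/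
theorem bsdp_two_bb2
    (hKato : ∀ (W : WeierstrassCurve ℚ) [W.IsElliptic] [W.IsGloballyMinimal],
      ¬ W.HasCM → Mult W 2 → O1.KatoMultiplicativeDivisibilityRat W 2)
    (h41ns : thm41Analogue_charValue_rankZero_numberField_anyPrime)
    (h41sp : thm41Analogue_charValue_rankZero_split_baseChange_anyPrime)
    (hmod : nonempty_modularParametrizationData)
    (hGZK : rank_eq_analyticRank_of_analyticRank_le_one)
    (hCassels : bsdRHS_eq_of_isIsogenous)
    (h514 : prop514_isTorsion_mu_eq_zero_two)
    (hC : cesnavicius_not_two_dvd_maninConstant_of_two_dvd_level)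
    (hGS : ∀ (W : WeierstrassCurve ℚ) [W.IsElliptic] [W.IsGloballyMinimal],
      W.HasSplitMultiplicativeReductionAtPrime 2 → greenberg_stevens (W := W) (p := 2))
    (hL : hasEntireLFunction_rat)
    (hper₀ : ∀ [NeZero (bb2.conductorNorm ℤ)] (f : CuspForm (Gamma0 (bb2.conductorNorm ℤ)) 2),
      IsNewformOf bb2 f → ∀ ϖ : ℚ, (ϖ : ℝ) * bb2.realPeriodRat = plusPeriod f → 0 ≤ padicValRat 2 ϖ)
    (hr : bb2.analyticRank = 0) (hq : shaAn bb2 = ((16 : ℚ) : ℂ)) (hdvd : 2 ^ 4 ∣ bb2.shaOrder) :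
    BSDp bb2 2 := by
  have hv : padicValRat 2 (16 : ℚ) ≤ ((4 : ℕ) : ℤ) := by
    rw [show (16 : ℚ) = ((2 ^ 4 : ℕ) : ℚ) by norm_num, padicValRat.of_nat, padicValNat.prime_pow]
  exact bsdp_two_mult_of_roadMember_of_levelMember hKato h41ns h41sp hmod hGZK hCassels h514 hC hGS hL
    bb2 hr mult_two_bb2 bb2 (IsIsogenous.refl_holds bb2) (Or.inr bb2_prop514)
    (Or.inr (Or.inr fun {_} f hf ϖ hϖ => hper₀ f hf ϖ hϖ)) bb2 (IsIsogenous.refl_holds bb2) hq hv hdvd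

/-- **`BSD(·,2)` FOR THE WHOLE CLASS 225330bb** (bb1, bb2, bb3, bb4; `#Ш_an = 64, 16, 64, 64`) from
`bsdp_two_bb2` by the isogeny invariance of `BSD(·,2)` in analytic rank `≤ 1` (`O1.bsdp_two_iff_of_isIsogenous`)
along the kernel-checked Vélu `2`-isogenies. With this file every analytic-rank-0 K = 2 multiplicative
class below `5·10⁵` has a `BSD(·,2)` certificate at engine/kernel tier (1 854 by descent alone, this one
by the two lanes). Nothing is booked. [cite: Cassels1965ArithmeticVIII, Thm. 1.3 (isogeny invariance)]
[cite: GreenbergLNM1716, Prop. 5.14] [cite: Miller2011LMS, Def. 1.1] -/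
theorem bsdp_two_class
    (hKato : ∀ (W : WeierstrassCurve ℚ) [W.IsElliptic] [W.IsGloballyMinimal],
      ¬ W.HasCM → Mult W 2 → O1.KatoMultiplicativeDivisibilityRat W 2)
    (h41ns : thm41Analogue_charValue_rankZero_numberField_anyPrime)
    (h41sp : thm41Analogue_charValue_rankZero_split_baseChange_anyPrime)
    (hmod : nonempty_modularParametrizationData)
    (hGZK : rank_eq_analyticRank_of_analyticRank_le_one)
    (hCassels : bsdRHS_eq_of_isIsogenous)
    (h514 : prop514_isTorsion_mu_eq_zero_two)
    (hC : cesnavicius_not_two_dvd_maninConstant_of_two_dvd_level)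
    (hGS : ∀ (W : WeierstrassCurve ℚ) [W.IsElliptic] [W.IsGloballyMinimal],
      W.HasSplitMultiplicativeReductionAtPrime 2 → greenberg_stevens (W := W) (p := 2))
    (hL : hasEntireLFunction_rat)
    (hper₀ : ∀ [NeZero (bb2.conductorNorm ℤ)] (f : CuspForm (Gamma0 (bb2.conductorNorm ℤ)) 2),
      IsNewformOf bb2 f → ∀ ϖ : ℚ, (ϖ : ℝ) * bb2.realPeriodRat = plusPeriod f → 0 ≤ padicValRat 2 ϖ)
    (hr : bb2.analyticRank = 0) (hq : shaAn bb2 = ((16 : ℚ) : ℂ)) (hdvd : 2 ^ 4 ∣ bb2.shaOrder) :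
    BSDp bb1 2 ∧ BSDp bb2 2 ∧ BSDp bb3 2 ∧ BSDp bb4 2 := by
  have h2 : BSDp bb2 2 :=
    bsdp_two_bb2 hKato h41ns h41sp hmod hGZK hCassels h514 hC hGS hL hper₀ hr hq hdvd
  have hr2 : bb2.analyticRank ≤ 1 := by rw [hr]; exact zero_le_one
  refine ⟨?_, h2, ?_, ?_⟩
  · exact (O1.bsdp_two_iff_of_isIsogenous bb2 hGZK hCassels hL isIsogenous_bb1_bb2.symm_of_charZero hr2).mp h2
  · exact (O1.bsdp_two_iff_of_isIsogenous bb2 hGZK hCassels hL isIsogenous_bb2_bb3 hr2).mp h2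
  · exact (O1.bsdp_two_iff_of_isIsogenous bb2 hGZK hCassels hL isIsogenous_bb2_bb4 hr2).mp h2

end Summit.BirchSwinnertonDyer.BirchSwinnertonDyer.Theorems.L2C225330bb

end
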